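import Summits.QuantumFields.YangMills.Theorems.LangevinControlUVFemtoCurvatureSkewnessReduction
import Summits.QuantumFields.YangMills.Theorems.LangevinControlUVFemtoCurvatureSkewnessImpliesC

/-!
# Crux `FemtoCurvatureSkewnessC` (stmt-QuantumFields-16205) — idea `ratio-transport`: first lemmas (crux-ideate r1, ideator 1)

Sketch for the idea card `Cruxes/FemtoCurvatureSkewnessC/Ideas/ratio-transport.md`.
TRANSPORT, DON'T EVALUATE: the tree-normalised skewness ratio
`u(L,β,n) := κ₃ · G_a(L,n) / (Cov^{3/2} · G_d(L,n))` (G_a, G_d = the explicit zero-mode-free transverse torus propagators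
`torusPropAxis`, `torusPropDiag` of the landed `PerpPropagatorPos` / `TreeRatioFloor`) is carried from finitely many
fixed-torus `β → ∞` corners (`FixedTorusAnchors`, FTEN WITH VALUE) to every femto box of an honest package map by three
SIGN-FREE transports — cutoff halving along the map's RG chain (`CutoffTransport`, summable increments), volume reduction at
fixed coupling (`VolumeTransport`, `(n/L')⁴`), separation parity (`SeparationTransport`, `C/n`).  A positive floor of `u` is
`SignedRigidity` (via the landed `TreeRatioFloor`), hence the skewness package (landed `skewnessPackage_of_signedRigidity`), hence
the served crux (landed `femtoCurvatureSkewnessC_iff`).  Everything here ELABORATES; the three `sorry`s are the line's future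
composition lemmas (pure real analysis / plumbing), not physics.
-/

set_option autoImplicit false

noncomputable section

namespace Summit.QuantumFields.YangMills.Cruxes.FemtoCurvatureSkewnessC.RatioTransport

open MeasureTheory Filter Topology
open scoped BigOperators
open Literature.MathematicalPhysics.QuantumFieldTheory
open Summit.QuantumFields.YangMills.Theorems.FemtoCurvatureSkewness.Negative
  (plaq wE wCov kappa3 TwoPointPackage SkewnessPackage)
open Summit.QuantumFields.YangMills.Cruxes.FemtoCurvatureSkewness.CouplingCubicResponse
  (covAxis torusPropAxis torusPropDiag IsHonestUnitMap SignedRigidity TreeRatioFloor treeRatioFloor_holds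
   torusPropAxis_pos torusPropDiag_pos skewnessPackage_of_signedRigidity)
open Summit.QuantumFields.YangMills.Theses.LangevinControlUV (FemtoCurvatureSkewnessC)
open Summit.QuantumFields.YangMills.Theorems.FemtoCurvatureSkewness (femtoCurvatureSkewnessC_iff)

section Vocabulary

variable {G : Type} [Group G] [TopologicalSpace G] [IsTopologicalGroup G] [CompactSpace G]
  [MeasurableSpace G] [BorelSpace G]

/-- **The tree-normalised skewness ratio** `u(L,β,n) := κ₃(L,β,n) · G_a(L,n) / (Cov_axis(L,β,n)^{3/2} · G_d(L,n))`.
At tree level (permanental triangle `κ₃ = 8dλ³G_a²G_d`, `Cov = 2dλ²G_a²`) it equals the pure number `2^{3/2} d^{-1/2}`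
— independent of `L`, `β`, `n`, of the coupling factor `λ`, of the composite normalisation and of the lattice artefacts of
`G_a`, `G_d` (which are divided out EXACTLY).  Meaningful where `Cov_axis > 0` (guaranteed on package boxes). -/
def skewRatioT (r : LatticeRep G) (L : ℕ) [NeZero L] (β : ℝ) (n : ℕ) : ℝ :=
  kappa3 r L β n * torusPropAxis L n / ((covAxis r L β n) ^ (3 / 2 : ℝ) * torusPropDiag L n)

/-- **(A) Fixed-torus anchors — FTEN with value.**  On every FIXED torus `L₀ ≥ 8n₀` the ratio has a positive eventual lower
bound as `β → ∞` (finite-dimensional Laplace asymptotics around the flat-connection variety, torons included; the line only ever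
USES finitely many `(L₀, n₀)`, namely `N₀ ≤ n₀ < 2N₀`, `8n₀ ≤ L₀ ≤ K₀ n₀`). This is the ONLY signed input of the line. -/
def FixedTorusAnchors (r : LatticeRep G) : Prop :=
  ∀ (L₀ n₀ : ℕ) [NeZero L₀], 1 ≤ n₀ → 8 * n₀ ≤ L₀ →
    ∃ u₀ : ℝ, 0 < u₀ ∧ ∀ᶠ β in atTop, u₀ ≤ skewRatioT r L₀ β n₀

/-- **(T_c) Cutoff transport along the dyadic RG chain of the unit map `a`** (sign-free; the engine statement of the line):
halving the cutoff at fixed physical triangle and box — `(L,β,n) ↦ (2L, β⁺, 2n)` with `2·a(β⁺) = a(β)` — moves the ratio by at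
most `ε(n)`, and the increments are summable along every dyadic chain with a tail that is small for large starting separation. -/
def CutoffTransport (r : LatticeRep G) (a : ℝ → ℝ) : Prop :=
  ∃ (β₁ ℓ₁ : ℝ) (ε : ℕ → ℝ), 0 < ℓ₁ ∧
    (∀ δ : ℝ, 0 < δ → ∃ N₀ : ℕ, 1 ≤ N₀ ∧ ∀ n₀ K : ℕ, N₀ ≤ n₀ → ∑ k ∈ Finset.range K, ε (2 ^ k * n₀) ≤ δ) ∧
    ∀ (L L' : ℕ) [NeZero L] [NeZero L'] (β β' : ℝ) (n : ℕ), β₁ ≤ β → (L : ℝ) * a β ≤ ℓ₁ → 1 ≤ n → 8 * n ≤ L →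
      L' = 2 * L → 2 * a β' = a β →
        |skewRatioT r L' β' (2 * n) - skewRatioT r L β n| ≤ ε n

/-- **(T_v) Volume transport at fixed coupling** (sign-free, DIFFERENTIAL form): at the same `β` and `n`, shrinking the
femto torus from `L` to `L' ∈ [L/2, L]` (`L' ≥ 8n`) moves the ratio by at most `C_V (n/L')⁴ · (L − L')/L'` — the triangle feels
the box only through modes of wavelength `≥ L'` (zero modes / torons / images), a finite-size correction of relative size
`(n/L')⁴` that is smooth in the box size.  Telescoped over dyadic `L'` it gives the coarse bound `1.07·C_V (n/L')⁴` for ANY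
`8n ≤ L' ≤ L` (used once, to come down to aspect ratio `L/n ≤ K₀`); in the differential form it also pays for rounding `L` to a
dyadic multiple (`(L−L')/L' ≤ 1/(8n₀)`, used once). -/
def VolumeTransport (r : LatticeRep G) (a : ℝ → ℝ) : Prop :=
  ∃ (β₁ ℓ₁ C_V : ℝ), 0 < ℓ₁ ∧
    ∀ (L L' : ℕ) [NeZero L] [NeZero L'] (β : ℝ) (n : ℕ), β₁ ≤ β → (L : ℝ) * a β ≤ ℓ₁ →
      1 ≤ n → 8 * n ≤ L' → L' ≤ L → L ≤ 2 * L' →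
        |skewRatioT r L β n - skewRatioT r L' β n| ≤ C_V * ((n : ℝ) / L') ^ 4 * (((L : ℝ) - L') / L')

/-- **(T_s) Separation transport** (sign-free): at fixed `(L, β)` the ratio is `C_S/n`-Lipschitz in the separation (smoothness of
the two- and three-point functions in one position at scale `n`; used at most once per dyadic level to fix parities). -/
def SeparationTransport (r : LatticeRep G) (a : ℝ → ℝ) : Prop :=
  ∃ (β₁ ℓ₁ C_S : ℝ), 0 < ℓ₁ ∧
    ∀ (L : ℕ) [NeZero L] (β : ℝ) (n : ℕ), β₁ ≤ β → (L : ℝ) * a β ≤ ℓ₁ →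
      1 ≤ n → 8 * (n + 1) ≤ L →
        |skewRatioT r L β (n + 1) - skewRatioT r L β n| ≤ C_S / n

/-- A positive floor of the ratio on the femto boxes of `a`. -/
def RatioFloor (r : LatticeRep G) (a : ℝ → ℝ) : Prop :=
  ∃ (β₁ ℓ₁ u₁ : ℝ), 0 < ℓ₁ ∧ 0 < u₁ ∧
    ∀ (L : ℕ) [NeZero L] (β : ℝ) (n : ℕ), β₁ ≤ β → (L : ℝ) * a β ≤ ℓ₁ →
      1 ≤ n → 8 * n ≤ L → u₁ ≤ skewRatioT r L β n

end Vocabulary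

/-- **The engine statement of the line (shape of the landed `MarkedCouplingDominance`, sign-free content):** for compact simple
`G` and any `r`, if some continuous unit map carries the two-point package then some HONEST unit map carries the package together
with the three transports. -/
def RatioTransportEngine : Prop :=
  ∀ (G : Type) [Group G] [TopologicalSpace G] [IsTopologicalGroup G] [CompactSpace G]
    [MeasurableSpace G] [BorelSpace G], IsCompactSimpleLieGroup G →
    ∀ (r : LatticeRep G), (∃ a : ℝ → ℝ, Continuous a ∧ TwoPointPackage r a) →
      ∃ a : ℝ → ℝ, IsHonestUnitMap a ∧ TwoPointPackage r a ∧
        CutoffTransport r a ∧ VolumeTransport r a ∧ SeparationTransport r a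

/-- **The anchors, all groups.** -/
def Anchors : Prop :=
  ∀ (G : Type) [Group G] [TopologicalSpace G] [IsTopologicalGroup G] [CompactSpace G]
    [MeasurableSpace G] [BorelSpace G], IsCompactSimpleLieGroup G →
    ∀ (r : LatticeRep G), FixedTorusAnchors r

section Composition

variable {G : Type} [Group G] [TopologicalSpace G] [IsTopologicalGroup G] [CompactSpace G]
  [MeasurableSpace G] [BorelSpace G]

/-- **FIRST LEMMA (pure real analysis, provable now): anchors + three transports ⇒ a ratio floor.**  Choose `K₀` with
`C_V K₀⁻⁴ ≤ u_A/8`, `N₀` with `2C_S/N₀ ≤ u_A/8` and the dyadic tail `Σ ε ≤ u_A/8` (from `CutoffTransport`'s summability), `u_A` the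
minimum of the finitely many anchor constants over `N₀ ≤ n₀ < 2N₀`, `8n₀ ≤ L₀ ≤ K₀n₀`; descend from a femto `(L,β,n)`:
(S) once, `n ↦ n' := 2^k n₀` (`n₀ := ⌊n/2^k⌋ ∈ [N₀, 2N₀)`, cost `≤ C_S (n−n')/n' ≤ C_S/N₀`); (V) once, `L ↦ 2^k⌊L/2^k⌋` (differential
clause, cost `≤ C_V 8⁻⁵/N₀`) and, if the aspect ratio exceeds `K₀`, down to `2^k K₀ n₀` (telescoped clause, cost `≤ 1.07 C_V K₀⁻⁴`);
(C) `k` halvings along the chain `a(β_{j+1}) = 2a(β_j)` (same physical box and triangle; cost `Σ_{i<k} ε(2^i n₀) ≤ u_A/8`), landing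
on the anchor `(⌊L/2^k⌋ ∧ K₀n₀, β_k, n₀)` whose coupling satisfies `a(β_k) ≤ ℓ₁/(8N₀)`, i.e. `β_k ≥ β_A` once `ℓ₁` is small
(honest `a`: strictly antitone, so small values of `a` force large `β`; intermediate levels exist by the intermediate value
theorem, landed `exists_later_level`). Total loss `≤ u_A/2`. -/
theorem ratioFloor_of_transports (r : LatticeRep G) {a : ℝ → ℝ} (ha : IsHonestUnitMap a)
    (hP : TwoPointPackage r a) (hA : FixedTorusAnchors r) (hc : CutoffTransport r a)
    (hv : VolumeTransport r a) (hs : SeparationTransport r a) : RatioFloor r a := by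
  sorry

/-- **Ratio floor ⇒ signed rigidity** (elementary: `κ₃ = u · Cov^{3/2} · G_d/G_a ≥ u₁ ρ₀ · Cov^{3/2}` by the LANDED
`TreeRatioFloor` (`ρ₀ G_a ≤ G_d`) and `torusPropAxis_pos`; `Cov_axis > 0` on package boxes by the package's lower clause). -/
theorem signedRigidity_of_ratioFloor (r : LatticeRep G) {a : ℝ → ℝ} (hP : TwoPointPackage r a)
    (hT : TreeRatioFloor) (hF : RatioFloor r a) : SignedRigidity r a := by
  sorry

end Composition

/-- **The line concludes the served crux BY NAME**: engine (sign-free transports for an honest package map) + anchors (FTEN with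
value on fixed tori) ⇒ `FemtoCurvatureSkewnessC` — through the landed `skewnessPackage_of_signedRigidity` and
`femtoCurvatureSkewnessC_iff`; the output map is the engine's honest map (continuous by `IsHonestUnitMap`). -/
theorem femtoCurvatureSkewnessC_of_ratioTransport (hE : RatioTransportEngine) (hA : Anchors) :
    FemtoCurvatureSkewnessC := by
  rw [femtoCurvatureSkewnessC_iff]
  intro G _ _ _ _ hG
  letI : MeasurableSpace G := borel G
  haveI : BorelSpace G := ⟨rfl⟩
  intro r hex
  obtain ⟨a, ha, hP, hc, hv, hs⟩ := hE G hG r hex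
  have hF : RatioFloor r a := ratioFloor_of_transports r ha hP (hA G hG r) hc hv hs
  have hR : SignedRigidity r a := signedRigidity_of_ratioFloor r hP treeRatioFloor_holds hF
  exact ⟨a, ha.2.2.1, hP, skewnessPackage_of_signedRigidity r hP hR⟩

end Summit.QuantumFields.YangMills.Cruxes.FemtoCurvatureSkewnessC.RatioTransport

end
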